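import Summits.Ventures.HSemireg.WedgeHankelRecurrenceSynthesisDivisors
import Summits.Ventures.HSemireg.WedgeHankelRecurrenceAffinePolar

/-!
# Venture HSemireg — SYLVESTER ON `P¹` WITH ALL MULTIPLICITIES: **for distinct affine nodes `λ_i` with orders `P_i` (`D = Σ_i (P_i + 1)`) and an order `e ≥ 1` at infinity,
# `R(q) = D + e` and `Π_i (X − λ_i)^{P_i+1} ∈ Rec_{D+e}(q)` iff `q = Σ_i expMul λ_i q_i + τ` on `[0, N]` with EXACT orders `q_i(P_i) ≠ 0` and a polar part `τ` of EXACT order `e`**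
# (`τ = 0` on `[0, N − e]`, `τ_{N+1−e} ≠ 0`; `2(D + e) ≤ N + 1`), uniquely; on the way, **the orders of a divisor class are exact iff its middle rank is `D`**

HONEST FRAMING. Part of the Lean index of the computation cell `pub-hsemireg` (seat p10 gen 27, Sunday typer «UNIFORM-IN-n»).
LINEAR ALGEBRA OF HANKEL (catalecticant) MATRICES and of polynomials over a field ONLY: no variety, no cohomology theory, no sheaf, no Ext group and no semiregularity map is constructed
here; nothing here says that HC / HC_CM / HC_AV holds; no Literature fact is declared or used.  Custodian versions as in `WedgeHankelSiegelIdeal` (1/3); the dictionary (`Σ_i expMul λ_i q_i`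
= a divisor class `Σ_i exp(λ_i Θ) v_i` on the affine rational normal curve; a tail on `(N − e, N]` = a polar part of order `e` at `∞`; the split recurrence `Π_i (X − λ_i)^{P_i+1}` of degree
`D < D + e` = the binary form `y^e Π_i (x − λ_i y)^{P_i+1}` = the divisor `Σ (P_i+1)[λ_i] + e[∞]` on `P¹`; «generalised Sylvester / apolarity») is QUOTED, never asserted.

WHAT IS KEYED / IN THE TREE.  N30 (`WedgeHankelRecurrenceSynthesisDivisors`, № 243): `exists_divisor_of_divisorPoly_mem_recSpace`, `divisor_coeffs_unique`; N34 (`WedgeHankelRecurrenceAffinePolar`,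
claim #4 v2 of p10 g27): `rank_hankel1_half_affine`, `tail_apply_ne_zero`, `rank_hankel1_half_congr`; N33 (№ 264): `mem_recSpace_add_add_iff`, `rank_hankel1_half_add_tail`,
`recSpace_add_tail_self_eq_span`; N20 (№ 181): `X_sub_C_pow_mem_recSpace_expMul`, `prod_mem_recSpace_sum`, `divisorPoly_mem_recSpace`, `divisorPoly_ne_zero`, `natDegree_divisorPoly`,
`rank_hankel1_half_divisor`, `expMul_zero_seq`, `hkFun_zero_seq`; N7 `sum_expMul_eq`; N23 (№ 176) `recSpace_congr`; N18 (№ 173) `recSpace_eq_bot_of_lt`, `mem_recSpace_iff`, `mem_degreeLT_succ_iff`.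
THIS FILE (namespace `Summit.Ventures.HSemireg.Wedge.HankelOuter` continued; CHAINED on N30 (№ 243) + N34; 0 definitions):
* §518 EXACT ORDERS ⟺ FULL MIDDLE RANK: `X_sub_C_pow_mem_recSpace_expMul_of_apply_eq_zero` (order `≤ P` with `q_P = 0 ⇒ (X − λ)^P ∈ Rec_P(expMul λ q)`),
  **`exists_mem_recSpace_divisor_of_apply_eq_zero`** (some `q_i(P_i) = 0 ⇒` a monic recurrence of degree `D − 1`, the reduced divisor polynomial), **`rank_hankel1_half_divisor_lt_of_apply_eq_zero`**
  (`⇒ R < D`), **`rank_hankel1_half_divisor_eq_iff_forall_apply_ne_zero`** (distinct nodes, orders `≤ P_i`, `2D ≤ N + 1`: `R(Σ_i expMul λ_i q_i) = D ↔ ∀ i, q_i(P_i) ≠ 0`).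
* §519 THE `P¹` SYNTHESIS: `exists_divisor_eq_below_of_divisorPoly_mem_recSpace` (`Π(X − λ_i)^{P_i+1} ∈ Rec_{D+e}(q)`, `e ≤ N ⇒ q` is a divisor class of orders `≤ P_i` on `[0, N − e]`),
  **`rank_half_eq_and_divisorPoly_mem_recSpace_iff`** (THE THEOREM above, `1 ≤ e`), **`divisor_polar_unique`** (the `q_i` and the tail on `[0, N]` are unique),
  **`rank_half_eq_and_divisorPoly_mem_recSpace_iff_of_affine`** (`e = 0`: `R(q) = D ∧ Π(X − λ_i)^{P_i+1} ∈ Rec_D(q) ↔ q` is a divisor class with EXACT orders on `[0, N]`).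
READING: N23/N29/N30 synthesised secant classes, secant + one simple node at `∞`, and divisor classes; N33/N34 supplied the polar part of any order; this file assembles the general split
case — every configuration «`Σ (P_i + 1)[λ_i] + e[∞]`» on `P¹` — and adds the converse exactness: a divisor class reaches middle rank `D` only with its true multiplicities.  Non-split `m`
is N34's `dualSeq` form.  Nothing Ext-side.  New names only.
-/

open Module Polynomial
open scoped Matrix Polynomial

namespace Summit.Ventures.HSemireg.Wedge.HankelOuter

open Summit.Ventures.HSemireg.Wedge Summit.Ventures.HSemireg.Wedge.Hankel Summit.Ventures.HSemireg.Wedge.HankelFrameChange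

variable (K : Type*) [Field K] {N : ℕ}

/-! ## §518. A divisor class has middle rank `D` iff its orders are exact -/

/-- a node carrying a sequence of order `≤ P` whose `P`-th coefficient VANISHES already satisfies `(X − λ)^P`: `(X − λ)^P ∈ Rec_P(expMul λ q)` (every `N`). -/
theorem X_sub_C_pow_mem_recSpace_expMul_of_apply_eq_zero (lam : K) {P : ℕ} {q : ℕ → K} (hq : ∀ j, P < j → q j = 0) (h0 : q P = 0) :
    (Polynomial.X - Polynomial.C lam) ^ P ∈ recSpace K N (expMul K lam q) P := by
  rcases Nat.eq_zero_or_pos P with rfl | hP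
  · have hz : q = 0 := funext fun j => by
      rcases Nat.eq_zero_or_pos j with rfl | hj
      · exact h0
      · exact hq j hj
    rw [hz, expMul_zero_seq, pow_zero, mem_recSpace_iff]
    exact ⟨(mem_degreeLT_succ_iff K).mpr (by rw [Polynomial.natDegree_one]), fun s _ => by rw [hkFun_zero_seq]⟩
  · obtain ⟨P', rfl⟩ := Nat.exists_eq_add_of_le' hP
    exact X_sub_C_pow_mem_recSpace_expMul K lam (P := P') fun j hj => by
      rcases Nat.lt_or_ge P' j |>.resolve_right (by omega) |> fun h => Nat.lt_or_eq_of_le (Nat.succ_le_of_lt h) with hlt | heq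
      · exact hq j hlt
      · rw [← heq]; exact h0

/-- **if some order is not exact (`q_{i₀}(P_{i₀}) = 0`), the REDUCED divisor polynomial `Π_{i ≠ i₀} (X − λ_i)^{P_i+1} · (X − λ_{i₀})^{P_{i₀}}`, monic of degree `D − 1`, is a recurrence
of the divisor class** (every `N`, any nodes). -/
theorem exists_mem_recSpace_divisor_of_apply_eq_zero {r : ℕ} (lam : Fin r → K) {P : Fin r → ℕ} {q : Fin r → ℕ → K} (hq : ∀ i j, P i < j → q i j = 0)
    (i₀ : Fin r) (h0 : q i₀ (P i₀) = 0) :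
    ∃ p : K[X], p.Monic ∧ p.natDegree + 1 = ∑ i, (P i + 1) ∧ p ∈ recSpace K N (fun j => ∑ i, expMul K (lam i) (q i) j) p.natDegree := by
  classical
  set rs : Fin r → ℕ := fun i => if i = i₀ then P i else P i + 1 with hrs
  set ms : Fin r → K[X] := fun i => (Polynomial.X - Polynomial.C (lam i)) ^ rs i with hms
  have hmem : ∀ i ∈ (Finset.univ : Finset (Fin r)), ms i ∈ recSpace K N (expMul K (lam i) (q i)) (rs i) := by
    intro i _
    simp only [hms, hrs]
    by_cases hi : i = i₀
    · rw [if_pos hi]; subst hi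
      exact X_sub_C_pow_mem_recSpace_expMul_of_apply_eq_zero K (lam i) (hq i) h0
    · rw [if_neg hi]
      exact X_sub_C_pow_mem_recSpace_expMul K (lam i) (hq i)
  have hprod := prod_mem_recSpace_sum K Finset.univ ms rs (fun i => expMul K (lam i) (q i)) hmem
  have hmonic : (∏ i, ms i).Monic := Polynomial.monic_prod_of_monic _ _ fun i _ => (Polynomial.monic_X_sub_C (lam i)).pow _
  have hdeg : (∏ i, ms i).natDegree = ∑ i, rs i := by
    rw [Polynomial.natDegree_prod_of_monic _ _ fun i _ => (Polynomial.monic_X_sub_C (lam i)).pow _]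
    exact Finset.sum_congr rfl fun i _ => natDegree_X_sub_C_pow' K (lam i) _
  have hsum : (∑ i, rs i) + 1 = ∑ i, (P i + 1) := by
    have h1 : ∑ i ∈ Finset.univ.erase i₀, rs i = ∑ i ∈ Finset.univ.erase i₀, (P i + 1) :=
      Finset.sum_congr rfl fun i hi => by simp only [hrs, if_neg (Finset.ne_of_mem_erase hi)]
    rw [← Finset.add_sum_erase _ rs (Finset.mem_univ i₀), ← Finset.add_sum_erase _ (fun i => P i + 1) (Finset.mem_univ i₀), h1]
    simp only [hrs, if_pos rfl]
    omega
  refine ⟨∏ i, ms i, hmonic, by rw [hdeg, hsum], ?_⟩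
  rw [sum_expMul_eq, hdeg]
  exact hprod

/-- **… hence a divisor class with a non-exact order has middle rank `< D`** (every `N`). -/
theorem rank_hankel1_half_divisor_lt_of_apply_eq_zero {r : ℕ} (lam : Fin r → K) {P : Fin r → ℕ} {q : Fin r → ℕ → K} (hq : ∀ i j, P i < j → q i j = 0)
    (i₀ : Fin r) (h0 : q i₀ (P i₀) = 0) :
    (hankel1 K N (N / 2) (fun j => ∑ i, expMul K (lam i) (q i) j)).rank < ∑ i, (P i + 1) := by
  obtain ⟨p, hp, hdeg, hmem⟩ := exists_mem_recSpace_divisor_of_apply_eq_zero K (N := N) lam hq i₀ h0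
  by_contra hge
  have h0' := recSpace_eq_bot_of_lt K (N := N) (q := fun j => ∑ i, expMul K (lam i) (q i) j) rfl
    (show p.natDegree < (hankel1 K N (N / 2) (fun j => ∑ i, expMul K (lam i) (q i) j)).rank by omega)
  rw [h0', Submodule.mem_bot] at hmem
  exact hp.ne_zero hmem

/-- **EXACT ORDERS ⟺ FULL MIDDLE RANK: for distinct nodes, orders `≤ P_i` and `2D ≤ N + 1`, `R(Σ_i expMul λ_i q_i) = D ↔ ∀ i, q_i(P_i) ≠ 0`** (F2a for ⇐; the reduced divisor
polynomial for ⇒). -/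
theorem rank_hankel1_half_divisor_eq_iff_forall_apply_ne_zero {r : ℕ} {lam : Fin r → K} (hlam : Function.Injective lam) {P : Fin r → ℕ} {q : Fin r → ℕ → K}
    (hq : ∀ i j, P i < j → q i j = 0) (h2D : (∑ i, (P i + 1)) + (∑ i, (P i + 1)) ≤ N + 1) :
    (hankel1 K N (N / 2) (fun j => ∑ i, expMul K (lam i) (q i) j)).rank = ∑ i, (P i + 1) ↔ ∀ i, q i (P i) ≠ 0 := by
  constructor
  · intro h i h0
    exact (rank_hankel1_half_divisor_lt_of_apply_eq_zero K (N := N) lam hq i h0).ne h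
  · intro hqP
    exact rank_hankel1_half_divisor K hlam hq hqP h2D

/-! ## §519. Sylvester on `P¹` with multiplicities at the affine nodes and at infinity -/

/-- the affine part of a class with the split recurrence `Π_i (X − λ_i)^{P_i+1}` in window `D + e + 1` is a divisor class of orders `≤ P_i` on `[0, N − e]` (N33 window shift + N30). -/
theorem exists_divisor_eq_below_of_divisorPoly_mem_recSpace {r : ℕ} {lam : Fin r → K} (hlam : Function.Injective lam) (P : Fin r → ℕ) {e : ℕ} (he : e ≤ N) {q : ℕ → K}
    (hm : (∏ i, (Polynomial.X - Polynomial.C (lam i)) ^ (P i + 1)) ∈ recSpace K N q ((∑ i, (P i + 1)) + e)) :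
    ∃ qs : Fin r → ℕ → K, (∀ i j, P i < j → qs i j = 0) ∧ ∀ j, j + e ≤ N → q j = ∑ i, expMul K (lam i) (qs i) j := by
  obtain ⟨N', rfl⟩ := Nat.exists_eq_add_of_le' he
  rw [mem_recSpace_add_add_iff K ((mem_degreeLT_succ_iff K).mpr (natDegree_divisorPoly K lam P).le)] at hm
  obtain ⟨qs, hqs, h⟩ := exists_divisor_of_divisorPoly_mem_recSpace K hlam P hm
  exact ⟨qs, hqs, fun j hj => h j (by omega)⟩

/-- **SYLVESTER ON `P¹` WITH MULTIPLICITIES.  For distinct affine nodes `λ_i`, orders `P_i` (`D = Σ_i (P_i + 1)`), `1 ≤ e` and `2(D + e) ≤ N + 1`: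
`R(q) = D + e` and `Π_i (X − λ_i)^{P_i+1} ∈ Rec_{D+e}(q)`  iff  `q = Σ_i expMul λ_i q_i + τ` on `[0, N]` with EXACT orders (`q_i = 0` above `P_i`, `q_i(P_i) ≠ 0`) and a polar part `τ` of EXACT
order `e` at infinity (`τ = 0` on `[0, N − e]`, `τ_{N+1−e} ≠ 0`).** -/
theorem rank_half_eq_and_divisorPoly_mem_recSpace_iff {r : ℕ} {lam : Fin r → K} (hlam : Function.Injective lam) (P : Fin r → ℕ) {e : ℕ} (he : 1 ≤ e)
    (h2 : ((∑ i, (P i + 1)) + e) + ((∑ i, (P i + 1)) + e) ≤ N + 1) (q : ℕ → K) :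
    ((hankel1 K N (N / 2) q).rank = (∑ i, (P i + 1)) + e ∧ (∏ i, (Polynomial.X - Polynomial.C (lam i)) ^ (P i + 1)) ∈ recSpace K N q ((∑ i, (P i + 1)) + e))
      ↔ ∃ (qs : Fin r → ℕ → K) (τ : ℕ → K), (∀ i j, P i < j → qs i j = 0) ∧ (∀ i, qs i (P i) ≠ 0) ∧ (∀ j, j + e ≤ N → τ j = 0) ∧ τ (N + 1 - e) ≠ 0
          ∧ ∀ j ≤ N, q j = (∑ i, expMul K (lam i) (qs i) j) + τ j := by
  set m := ∏ i, (Polynomial.X - Polynomial.C (lam i)) ^ (P i + 1) with hmdef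
  have hm0 : m ≠ 0 := divisorPoly_ne_zero K lam P
  have hmd : m.natDegree = ∑ i, (P i + 1) := natDegree_divisorPoly K lam P
  constructor
  · rintro ⟨hq, hm⟩
    obtain ⟨qs, hqs, haff⟩ := exists_divisor_eq_below_of_divisorPoly_mem_recSpace K hlam P (by omega) hm
    have hmu : m ∈ recSpace K N (fun j => ∑ i, expMul K (lam i) (qs i) j) (∑ i, (P i + 1)) := divisorPoly_mem_recSpace K lam hqs
    have hu : (hankel1 K N (N / 2) (fun j => ∑ i, expMul K (lam i) (qs i) j)).rank = ∑ i, (P i + 1) := rank_hankel1_half_affine K hq rfl haff hmu hm0 h2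
    refine ⟨qs, q - fun j => ∑ i, expMul K (lam i) (qs i) j, hqs, (rank_hankel1_half_divisor_eq_iff_forall_apply_ne_zero K hlam hqs (by omega)).mp hu,
      fun j hj => by rw [Pi.sub_apply, haff j hj, sub_self], tail_apply_ne_zero K hq rfl haff hmu hm0 he, fun j _ => by rw [Pi.sub_apply]; ring⟩
  · rintro ⟨qs, τ, hqs, hqsP, hτ, hτe, h⟩
    set u : ℕ → K := fun j => ∑ i, expMul K (lam i) (qs i) j
    have hu : (hankel1 K N (N / 2) u).rank = ∑ i, (P i + 1) := rank_hankel1_half_divisor K hlam hqs hqsP (by omega)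
    have hmu : m ∈ recSpace K N u (∑ i, (P i + 1)) := divisorPoly_mem_recSpace K lam hqs
    have hagree : ∀ j ≤ N, q j = (u + τ) j := fun j hj => by rw [Pi.add_apply, h j hj]
    refine ⟨?_, ?_⟩
    · rw [rank_hankel1_half_congr K hagree]
      exact rank_hankel1_half_add_tail K hu hmu hm0 hmd hτ hτe he h2
    · rw [recSpace_congr K hagree, recSpace_add_tail_self_eq_span K hu hmu hm0 hmd hτ hτe he h2]
      exact Submodule.mem_span_singleton_self m

/-- **uniqueness of the `P¹` decomposition**: the node sequences `q_i` (orders `≤ P_i`) and the polar part on `[0, N]` are determined by `q` (`e ≤ N`, `D + e ≤ N + 1`, distinct nodes). -/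
theorem divisor_polar_unique {r : ℕ} {lam : Fin r → K} (hlam : Function.Injective lam) {P : Fin r → ℕ} {e : ℕ} (he : e ≤ N) (hDe : (∑ i, (P i + 1)) + e ≤ N + 1) {q : ℕ → K}
    {qs qs' : Fin r → ℕ → K} {τ τ' : ℕ → K} (hqs : ∀ i j, P i < j → qs i j = 0) (hqs' : ∀ i j, P i < j → qs' i j = 0)
    (hτ : ∀ j, j + e ≤ N → τ j = 0) (hτ' : ∀ j, j + e ≤ N → τ' j = 0)
    (h : ∀ j ≤ N, q j = (∑ i, expMul K (lam i) (qs i) j) + τ j) (h' : ∀ j ≤ N, q j = (∑ i, expMul K (lam i) (qs' i) j) + τ' j) :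
    qs = qs' ∧ ∀ j ≤ N, τ j = τ' j := by
  have hqq : qs = qs' := by
    refine divisor_coeffs_unique K (N := N - e) hlam (by omega) hqs hqs' fun j hj => ?_
    have h1 := h j (by omega)
    have h2 := h' j (by omega)
    rw [hτ j (by omega), add_zero] at h1
    rw [hτ' j (by omega), add_zero] at h2
    rw [← h1, ← h2]
  refine ⟨hqq, fun j hj => ?_⟩
  have h1 := h j hj
  rw [hqq, h' j hj] at h1
  exact (add_left_cancel h1).symm

/-- the case `e = 0` (no node at infinity): **`R(q) = D` and `Π_i (X − λ_i)^{P_i+1} ∈ Rec_D(q)` iff `q` is, on `[0, N]`, a divisor class on the `λ_i` with EXACT orders `P_i`** (`2D ≤ N + 1`). -/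
theorem rank_half_eq_and_divisorPoly_mem_recSpace_iff_of_affine {r : ℕ} {lam : Fin r → K} (hlam : Function.Injective lam) (P : Fin r → ℕ)
    (h2 : (∑ i, (P i + 1)) + (∑ i, (P i + 1)) ≤ N + 1) (q : ℕ → K) :
    ((hankel1 K N (N / 2) q).rank = ∑ i, (P i + 1) ∧ (∏ i, (Polynomial.X - Polynomial.C (lam i)) ^ (P i + 1)) ∈ recSpace K N q (∑ i, (P i + 1)))
      ↔ ∃ qs : Fin r → ℕ → K, (∀ i j, P i < j → qs i j = 0) ∧ (∀ i, qs i (P i) ≠ 0) ∧ ∀ j ≤ N, q j = ∑ i, expMul K (lam i) (qs i) j := by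
  constructor
  · rintro ⟨hq, hm⟩
    obtain ⟨qs, hqs, h⟩ := exists_divisor_of_divisorPoly_mem_recSpace K hlam P hm
    refine ⟨qs, hqs, (rank_hankel1_half_divisor_eq_iff_forall_apply_ne_zero K hlam hqs h2).mp ?_, h⟩
    rw [← rank_hankel1_half_congr K h, hq]
  · rintro ⟨qs, hqs, hqsP, h⟩
    refine ⟨?_, ?_⟩
    · rw [rank_hankel1_half_congr K h]
      exact rank_hankel1_half_divisor K hlam hqs hqsP h2
    · rw [recSpace_congr K h]
      exact divisorPoly_mem_recSpace K lam hqs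

end Summit.Ventures.HSemireg.Wedge.HankelOuter
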